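import Summits.CriticalPhenomena.PercolationContinuityZ3.Theorems.Transplant.FKDoubleFanWordCellsFactor
import Summits.CriticalPhenomena.PercolationContinuityZ3.Theorems.Transplant.FKDoubleFanWordCellsMirror
import Summits.CriticalPhenomena.PercolationContinuityZ3.Theorems.Transplant.FKDoubleFanSeedCone
import HarnessLib

/-!
# Double fans `K₂ ∨ P_{m+1}`: the words with a `W_D` letter are FREE — their parts hold for every two-block pattern, every spoke
# weight and every `q ∈ [0,1]`, by the seed cone

Helper file (`--supports stmt-CriticalPhenomena-4575`), FK sub-lane `prim-bschramm-fk-3` (gen 50); builds on p205010 (kernel theorem, internal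
audit signed; external expert review pending).  No named facts, no sorries, default heartbeats; standard axioms.  Memo
`bschramm/prim-bschramm-fk-3/FAR-CROSS-XXV.md` §2.

`…WordCellsFactor` reduced the parts condition `PartsOK q k0 k1 k2 x1 y1 x2 y2` of a rim word containing the letter `0 = W_D` to ONE-SIDED sign
conditions (`partsOK_zero_first/last/mid`): the pairing of a word applied to `a∧b = bivAB` with a target generator, resp. the `D`-form of a word
applied to an input generator.  In the distance-3 campaigns these one-sided factors were certified pattern by pattern (MIN: 133 tensor-Bernstein
certificates, files `…D3MinW1–W7`).  This file proves them STRUCTURALLY, once and for all patterns, from the seed cone of `…SeedCone` (gen 28):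
* `seedCone q` contains `bivAB` and is stable under the polarised letters; hence (**`seedCone_opAC_mem`**, **`seedCone_opBC_mem`**,
  **`seedCone_opE_mem`**, **`seedCone_rimOp_mem`**, **`seedCone_opBlocks_mem`**) under the WHOLE letters `∧²AC_x`, `∧²BC_y`, `∧²E_r`
  (`x, y, r ∈ [0,1]`, `0 ≤ q`) and under every middle word;
* (**`pairH_seedCone_targetBiv_nonneg`**) for `0 ≤ q ≤ 1` the seed cone pairs `≥ 0` with the target bivector of EVERY parts generator
  `A, D, AC, BD, 𝟙, R₀(w), R₁(w)` (`IsGenP`) — seven explicit Farkas identities in the facets of the cone, e.g. for `R₁(w)`: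
  `⟪β, targetBiv R₁(w)⟫ = (1−q)·[q(2−q)w²·β_uv + 2(2−q)w·(β_yv − β_uv) + (2−q)(1−w²)·ψ(β)]`;
* the input-side conditions follow by the apex mirror `swapYZ` (self-adjointness of the letters, `swapYZ bivAB = bivAB`).
Consequences: **`partsOK_W_first`**, **`partsOK_W_last`**, **`partsOK_W_mid`**, **`partsOK_of_hasW`** — the 19 words `κ ∈ {0,1,2}³` with a
zero letter satisfy `PartsOK` for ALL `q ∈ [0,1]` and ALL spokes `x1, y1, x2, y2 ∈ [0,1]` (MIN, JUN and every other two-block pattern); and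
**`cellsOK_twoBlocks_of_TIparts`**: the cells of a two-block pattern follow from the parts of the EIGHT `T/I`-words alone.  At the operator
level (**`pairH_opBlocks_bivAB_targetBiv_nonneg`**) the same holds at every rim distance.
[cite: Grimmett2006, §3.9 eq. (3.94) (pp. 63–64)] [folklore]
-/

noncomputable section

namespace Summit.CriticalPhenomena.PercolationContinuityZ3.Theorems

namespace FK

namespace ThreeApex

/-! ### The seed cone is stable under the whole letters and under every middle word -/

section Stability

variable {q : ℝ}

/-- A Bernstein-type combination `a•β + b•γ + c•δ` with `a, b, c ≥ 0` of seed-cone elements lies in the seed cone. [folklore] -/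
theorem seedCone_lin3_mem {a b c : ℝ} (ha : 0 ≤ a) (hb : 0 ≤ b) (hc : 0 ≤ c) {β γ δ : Biv} (hβ : β ∈ seedCone q)
    (hγ : γ ∈ seedCone q) (hδ : δ ∈ seedCone q) : Biv.lin3 a β b γ c δ ∈ seedCone q :=
  seedCone_add_mem (seedCone_smul_mem ha hβ) (seedCone_add_mem (seedCone_smul_mem hb hγ) (seedCone_smul_mem hc hδ))

/-- `∧²AC_x` maps the seed cone into itself (`0 ≤ q`, `x ∈ [0,1]`). [folklore] -/
theorem seedCone_opAC_mem (hq0 : 0 ≤ q) {x : ℝ} (hx0 : 0 ≤ x) (hx1 : x ≤ 1) {β : Biv} (hβ : β ∈ seedCone q) :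
    opAC x β ∈ seedCone q :=
  seedCone_lin3_mem (sq_nonneg _) (mul_nonneg hx0 (sub_nonneg.2 hx1)) (sq_nonneg _) hβ (seedCone_opTa_mem hq0 hβ)
    (seedCone_opWa_mem hq0 hβ)

/-- `∧²BC_y` maps the seed cone into itself (`0 ≤ q`, `y ∈ [0,1]`). [folklore] -/
theorem seedCone_opBC_mem (hq0 : 0 ≤ q) {y : ℝ} (hy0 : 0 ≤ y) (hy1 : y ≤ 1) {β : Biv} (hβ : β ∈ seedCone q) :
    opBC y β ∈ seedCone q :=
  seedCone_lin3_mem (sq_nonneg _) (mul_nonneg hy0 (sub_nonneg.2 hy1)) (sq_nonneg _) hβ (seedCone_opTb_mem hβ)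
    (seedCone_opWb_mem hq0 hβ)

/-- `∧²E_r` maps the seed cone into itself (`0 ≤ q`, `r ∈ [0,1]`). [folklore] -/
theorem seedCone_opE_mem (hq0 : 0 ≤ q) {r : ℝ} (hr0 : 0 ≤ r) (hr1 : r ≤ 1) {β : Biv} (hβ : β ∈ seedCone q) :
    opE q r β ∈ seedCone q :=
  seedCone_lin3_mem (sq_nonneg _) (mul_nonneg hr0 (sub_nonneg.2 hr1)) (sq_nonneg _) hβ (seedCone_opTD_mem hq0 hβ)
    (seedCone_opWD_mem hq0 hβ)

/-- The rim letters `W_D, T_D, I` map the seed cone into itself (`0 ≤ q`). [folklore] -/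
theorem seedCone_rimOp_mem (hq0 : 0 ≤ q) (k : ℕ) {β : Biv} (hβ : β ∈ seedCone q) : rimOp q k β ∈ seedCone q := by
  match k with
  | 0 => exact seedCone_opWD_mem hq0 hβ
  | 1 => exact seedCone_opTD_mem hq0 hβ
  | _ + 2 => exact hβ

/-- **Every middle word with unit weights maps the seed cone into itself** (`0 ≤ q`). [folklore] -/
theorem seedCone_opBlocks_mem (hq0 : 0 ≤ q) :
    ∀ (mids : List (ℝ × ℝ × ℝ)), UnitBlocks mids → ∀ {β : Biv}, β ∈ seedCone q → opBlocks q mids β ∈ seedCone q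
  | [], _, _, hβ => hβ
  | blk :: rest, hm, β, hβ => by
    have h := hm blk (List.mem_cons.2 (Or.inl rfl))
    exact seedCone_opBlocks_mem hq0 rest (fun b hb => hm b (List.mem_cons.2 (Or.inr hb)))
      (seedCone_opAC_mem hq0 h.2.2.1 h.2.2.2.1 (seedCone_opBC_mem hq0 h.2.2.2.2.1 h.2.2.2.2.2 (seedCone_opE_mem hq0 h.1 h.2.1 hβ)))

end Stability

/-! ### The seed cone pairs non-negatively with the target bivector of every parts generator -/

section Targets

variable {q : ℝ}

/-- On the block `uz = yz = xv = 0` the pairing with a target bivector has three terms. [folklore] -/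
theorem pairH_targetBiv_of_blockZero (q : ℝ) {β : Biv} (h2 : β.uz = 0) (h3 : β.yz = 0) (h4 : β.xv = 0) (S : P6) :
    pairH q β (targetBiv S) = (1 - q) * (S.zv * β.yv - (2 - q) * S.uv * β.uv - (1 - q) * S.xy * β.xz) := by
  simp only [pairH, targetBiv, h2, h3, h4]; ring

/-- **The seed cone pairs `≥ 0` with the target bivector of every parts generator** (`0 ≤ q ≤ 1`): explicit Farkas identities in the
facets of `seedCone q`. [folklore] -/
theorem pairH_seedCone_targetBiv_nonneg (hq0 : 0 ≤ q) (hq1 : q ≤ 1) {β : Biv} (hβ : β ∈ seedCone q) {S : P6} (hS : IsGenP q S) :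
    0 ≤ pairH q β (targetBiv S) := by
  simp only [seedCone, Set.mem_setOf_eq] at hβ
  obtain ⟨_, b2, b3, b4, f1, f2, f3, f4, f5, _, f7⟩ := hβ
  have hp : 0 ≤ 1 - q := sub_nonneg.2 hq1
  have h2q : 0 ≤ 2 - q := by linarith
  have hyv : 0 ≤ β.yv := by linarith
  have hyu : 0 ≤ β.yv - β.uv := by linarith
  have hxz : 0 ≤ -β.xz := by linarith
  have huv : 0 ≤ β.uv := by linarith
  rw [pairH_targetBiv_of_blockZero q b2 b3 b4]
  refine mul_nonneg hp ?_
  rcases hS with rfl | rfl | rfl | rfl | rfl | ⟨w, hw0, hw1, rfl | rfl⟩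
  · simp only [rayA]; linarith
  · simp only [rayD]; linarith
  · simp only [rayAC]; nlinarith [mul_nonneg hp hxz]
  · simp only [rayBD]; linarith
  · simp only [rayOne]; linarith
  · have hw1' : 0 ≤ 1 - w := sub_nonneg.2 hw1
    have e : (roofR0 q w).zv * β.yv - (2 - q) * (roofR0 q w).uv * β.uv - (1 - q) * (roofR0 q w).xy * β.xz =
        (2 - q) * w ^ 2 * β.yv + 2 * (2 - q) * w * (1 - w) * (β.yv - β.uv) := by
      simp only [roofR0, zwR]; ring
    rw [e]
    have t1 : 0 ≤ (2 - q) * w ^ 2 * β.yv := mul_nonneg (mul_nonneg h2q (sq_nonneg w)) hyv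
    have t2 : 0 ≤ 2 * (2 - q) * w * (1 - w) * (β.yv - β.uv) :=
      mul_nonneg (mul_nonneg (mul_nonneg (mul_nonneg (by norm_num) h2q) hw0) hw1') hyu
    linarith
  · have hww : 0 ≤ 1 - w ^ 2 := by nlinarith
    have e : (roofR1 q w).zv * β.yv - (2 - q) * (roofR1 q w).uv * β.uv - (1 - q) * (roofR1 q w).xy * β.xz =
        q * (2 - q) * w ^ 2 * β.uv + 2 * (2 - q) * w * (β.yv - β.uv) +
          (2 - q) * (1 - w ^ 2) * (β.yv - (2 - q) * β.uv - (1 - q) * β.xz) := by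
      simp only [roofR1, zwR, xwR]; ring
    rw [e]
    have t1 : 0 ≤ q * (2 - q) * w ^ 2 * β.uv := mul_nonneg (mul_nonneg (mul_nonneg hq0 h2q) (sq_nonneg w)) huv
    have t2 : 0 ≤ 2 * (2 - q) * w * (β.yv - β.uv) := mul_nonneg (mul_nonneg (mul_nonneg (by norm_num) h2q) hw0) hyu
    have t3 : 0 ≤ (2 - q) * (1 - w ^ 2) * (β.yv - (2 - q) * β.uv - (1 - q) * β.xz) := mul_nonneg (mul_nonneg h2q hww) f7
    linarith

/-- **`W`-words are free at every rim distance** (operator level): for every middle word with unit weights and every last rim weight in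
`[0,1]`, the image of `a∧b` pairs `≥ 0` with the target bivector of every parts generator (`0 ≤ q ≤ 1`). [folklore] -/
theorem pairH_opBlocks_bivAB_targetBiv_nonneg (hq0 : 0 ≤ q) (hq1 : q ≤ 1) {mids : List (ℝ × ℝ × ℝ)} (hm : UnitBlocks mids)
    {rd : ℝ} (hrd0 : 0 ≤ rd) (hrd1 : rd ≤ 1) {S : P6} (hS : IsGenP q S) :
    0 ≤ pairH q (opE q rd (opBlocks q mids bivAB)) (targetBiv S) :=
  pairH_seedCone_targetBiv_nonneg hq0 hq1 (seedCone_opE_mem hq0 hrd0 hrd1 (seedCone_opBlocks_mem hq0 mids hm (bivAB_mem_seedCone q))) hS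

end Targets

/-! ### The one-sided factors of the `W_D`-words of a two-block pattern -/

section OneSided

variable {q : ℝ} {k0 k1 k2 : ℕ} {x1 y1 x2 y2 : ℝ}

/-- `a∧b` is fixed by the apex mirror. [folklore] -/
theorem swapYZ_bivAB : Biv.swapYZ bivAB = bivAB := by
  ext <;> simp [Biv.swapYZ, bivAB]

/-- `⟪a∧b, γ⟫ = (1−q)·ℓ_D(γ)`. [folklore] -/
theorem pairH_bivAB_left (q : ℝ) (γ : Biv) : pairH q bivAB γ = (1 - q) * formD q γ := by
  simp only [pairH, bivAB, formD]; ring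

/-- **Target side of a whole word**: `⟪R_{k2}·AC_{x2}·BC_{y2}·R_{k1}·AC_{x1}·BC_{y1}(a∧b), targetBiv S⟫ ≥ 0` for every parts generator `S`
(`0 ≤ q ≤ 1`, spokes in `[0,1]`). [folklore] -/
theorem wordAB_targetBiv_nonneg (hq0 : 0 ≤ q) (hq1 : q ≤ 1) (hx10 : 0 ≤ x1) (hx11 : x1 ≤ 1) (hy10 : 0 ≤ y1) (hy11 : y1 ≤ 1)
    (hx20 : 0 ≤ x2) (hx21 : x2 ≤ 1) (hy20 : 0 ≤ y2) (hy21 : y2 ≤ 1) {S : P6} (hS : IsGenP q S) :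
    0 ≤ pairH q (rimOp q k2 (opAC x2 (opBC y2 (rimOp q k1 (opAC x1 (opBC y1 bivAB)))))) (targetBiv S) :=
  pairH_seedCone_targetBiv_nonneg hq0 hq1
    (seedCone_rimOp_mem hq0 k2 (seedCone_opAC_mem hq0 hx20 hx21 (seedCone_opBC_mem hq0 hy20 hy21
      (seedCone_rimOp_mem hq0 k1 (seedCone_opAC_mem hq0 hx10 hx11 (seedCone_opBC_mem hq0 hy10 hy11 (bivAB_mem_seedCone q))))))) hS

/-- Target side of the last block alone: `⟪R_{k2}·AC_{x2}·BC_{y2}(a∧b), targetBiv S⟫ ≥ 0`. [folklore] -/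
theorem blockAB_targetBiv_nonneg (hq0 : 0 ≤ q) (hq1 : q ≤ 1) (hx20 : 0 ≤ x2) (hx21 : x2 ≤ 1) (hy20 : 0 ≤ y2) (hy21 : y2 ≤ 1)
    {S : P6} (hS : IsGenP q S) : 0 ≤ pairH q (rimOp q k2 (opAC x2 (opBC y2 bivAB))) (targetBiv S) :=
  pairH_seedCone_targetBiv_nonneg hq0 hq1
    (seedCone_rimOp_mem hq0 k2 (seedCone_opAC_mem hq0 hx20 hx21 (seedCone_opBC_mem hq0 hy20 hy21 (bivAB_mem_seedCone q)))) hS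

/-- **Input side of a whole word** (by self-adjointness and the apex mirror):
`⟪AC_{x2}·BC_{y2}·R_{k1}·AC_{x1}·BC_{y1}·R_{k0}(inputBiv P), a∧b⟫ ≥ 0` for every parts generator `P`. [folklore] -/
theorem wordInput_bivAB_nonneg (hq0 : 0 ≤ q) (hq1 : q ≤ 1) (hx10 : 0 ≤ x1) (hx11 : x1 ≤ 1) (hy10 : 0 ≤ y1) (hy11 : y1 ≤ 1)
    (hx20 : 0 ≤ x2) (hx21 : x2 ≤ 1) (hy20 : 0 ≤ y2) (hy21 : y2 ≤ 1) {P : P6} (hP : IsGenP q P) :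
    0 ≤ pairH q (opAC x2 (opBC y2 (rimOp q k1 (opAC x1 (opBC y1 (rimOp q k0 (inputBiv P))))))) bivAB := by
  rw [pairH_opAC, pairH_opBC, pairH_rimOp, pairH_opAC, pairH_opBC, pairH_rimOp, ← swapYZ_targetBiv, pairH_swapYZ,
    swapYZ_rimOp, swapYZ_opBC, swapYZ_opAC, swapYZ_rimOp, swapYZ_opBC, swapYZ_opAC, swapYZ_bivAB]
  exact pairH_seedCone_targetBiv_nonneg hq0 hq1
    (seedCone_rimOp_mem hq0 k0 (seedCone_opAC_mem hq0 hy10 hy11 (seedCone_opBC_mem hq0 hx10 hx11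
      (seedCone_rimOp_mem hq0 k1 (seedCone_opAC_mem hq0 hy20 hy21 (seedCone_opBC_mem hq0 hx20 hx21 (bivAB_mem_seedCone q))))))) hP

/-- **Input side of the first block through the `D`-form** (`0 ≤ q < 1`): `ℓ_D(AC_{x1}·BC_{y1}·R_{k0}(inputBiv P)) ≥ 0` for every parts
generator `P`. [folklore] -/
theorem formD_blockInput_nonneg (hq0 : 0 ≤ q) (hq1 : q < 1) (hx10 : 0 ≤ x1) (hx11 : x1 ≤ 1) (hy10 : 0 ≤ y1) (hy11 : y1 ≤ 1)
    {P : P6} (hP : IsGenP q P) : 0 ≤ formD q (opAC x1 (opBC y1 (rimOp q k0 (inputBiv P)))) := by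
  have key : 0 ≤ pairH q bivAB (opAC x1 (opBC y1 (rimOp q k0 (inputBiv P)))) := by
    rw [pairH_comm, pairH_opAC, pairH_opBC, pairH_rimOp, ← swapYZ_targetBiv, pairH_swapYZ, swapYZ_rimOp, swapYZ_opBC,
      swapYZ_opAC, swapYZ_bivAB]
    exact pairH_seedCone_targetBiv_nonneg hq0 hq1.le
      (seedCone_rimOp_mem hq0 k0 (seedCone_opAC_mem hq0 hy10 hy11 (seedCone_opBC_mem hq0 hx10 hx11 (bivAB_mem_seedCone q)))) hP
  rw [pairH_bivAB_left] at key
  exact (mul_nonneg_iff_of_pos_left (sub_pos.2 hq1)).1 key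

end OneSided

/-! ### The `W_D`-words are free -/

section WFree

variable {q : ℝ} {k0 k1 k2 : ℕ} {x1 y1 x2 y2 : ℝ}

/-- At `q = 1` every polarized cell vanishes. [folklore] -/
theorem pcell2_q_one (k0 k1 k2 : ℕ) (x1 y1 x2 y2 : ℝ) (P S : P6) : pcell2 1 k0 k1 k2 x1 y1 x2 y2 P S = 0 := by
  simp only [pcell2, pairH]; ring

/-- **`W_D` first is free**: `PartsOK q 0 k1 k2 x1 y1 x2 y2` for all `q ∈ [0,1]` and all spokes in `[0,1]`. [folklore] -/
theorem partsOK_W_first (hq0 : 0 ≤ q) (hq1 : q ≤ 1) (hx10 : 0 ≤ x1) (hx11 : x1 ≤ 1) (hy10 : 0 ≤ y1) (hy11 : y1 ≤ 1)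
    (hx20 : 0 ≤ x2) (hx21 : x2 ≤ 1) (hy20 : 0 ≤ y2) (hy21 : y2 ≤ 1) : PartsOK q 0 k1 k2 x1 y1 x2 y2 :=
  partsOK_zero_first hq0 hq1 (fun _ hS => wordAB_targetBiv_nonneg hq0 hq1 hx10 hx11 hy10 hy11 hx20 hx21 hy20 hy21 hS)

/-- **`W_D` last is free**: `PartsOK q k0 k1 0 x1 y1 x2 y2` for all `q ∈ [0,1]` and all spokes in `[0,1]`. [folklore] -/
theorem partsOK_W_last (hq0 : 0 ≤ q) (hq1 : q ≤ 1) (hx10 : 0 ≤ x1) (hx11 : x1 ≤ 1) (hy10 : 0 ≤ y1) (hy11 : y1 ≤ 1)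
    (hx20 : 0 ≤ x2) (hx21 : x2 ≤ 1) (hy20 : 0 ≤ y2) (hy21 : y2 ≤ 1) : PartsOK q k0 k1 0 x1 y1 x2 y2 :=
  partsOK_zero_last hq0 hq1 (fun _ hP => wordInput_bivAB_nonneg hq0 hq1 hx10 hx11 hy10 hy11 hx20 hx21 hy20 hy21 hP)

/-- **`W_D` in the middle is free**: `PartsOK q k0 0 k2 x1 y1 x2 y2` for all `q ∈ [0,1]` and all spokes in `[0,1]`. [folklore] -/
theorem partsOK_W_mid (hq0 : 0 ≤ q) (hq1 : q ≤ 1) (hx10 : 0 ≤ x1) (hx11 : x1 ≤ 1) (hy10 : 0 ≤ y1) (hy11 : y1 ≤ 1)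
    (hx20 : 0 ≤ x2) (hx21 : x2 ≤ 1) (hy20 : 0 ≤ y2) (hy21 : y2 ≤ 1) : PartsOK q k0 0 k2 x1 y1 x2 y2 := by
  rcases eq_or_lt_of_le hq1 with rfl | hlt
  · intro P S _ _
    rw [pcell2_q_one]
  · exact partsOK_zero_mid (fun _ hP => formD_blockInput_nonneg hq0 hlt hx10 hx11 hy10 hy11 hP)
      (fun _ hS => blockAB_targetBiv_nonneg hq0 hq1 hx20 hx21 hy20 hy21 hS)

/-- **THE `W_D`-WORDS ARE FREE**: every rim word `κ = (k0,k1,k2)` with a letter `0 = W_D` satisfies its parts condition, for every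
`q ∈ [0,1]` and every two-block spoke pattern with weights in `[0,1]`. [folklore] -/
theorem partsOK_of_hasW (hq0 : 0 ≤ q) (hq1 : q ≤ 1) (hx10 : 0 ≤ x1) (hx11 : x1 ≤ 1) (hy10 : 0 ≤ y1) (hy11 : y1 ≤ 1)
    (hx20 : 0 ≤ x2) (hx21 : x2 ≤ 1) (hy20 : 0 ≤ y2) (hy21 : y2 ≤ 1) (h : k0 = 0 ∨ k1 = 0 ∨ k2 = 0) :
    PartsOK q k0 k1 k2 x1 y1 x2 y2 := by
  rcases h with rfl | rfl | rfl
  · exact partsOK_W_first hq0 hq1 hx10 hx11 hy10 hy11 hx20 hx21 hy20 hy21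
  · exact partsOK_W_mid hq0 hq1 hx10 hx11 hy10 hy11 hx20 hx21 hy20 hy21
  · exact partsOK_W_last hq0 hq1 hx10 hx11 hy10 hy11 hx20 hx21 hy20 hy21

/-- **Cells from the `T/I`-words alone**: for `q ∈ [0,1]` and all weights in `[0,1]`, the cells of the two-block pattern
`[(r0,x1,y1),(r1,x2,y2)] r2` follow from the parts conditions of the EIGHT words `κ ∈ {1,2}³`. [folklore] -/
theorem cellsOK_twoBlocks_of_TIparts {r0 r1 r2 : ℝ} (hq0 : 0 ≤ q) (hq1 : q ≤ 1) (hr00 : 0 ≤ r0) (hr01 : r0 ≤ 1)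
    (hr10 : 0 ≤ r1) (hr11 : r1 ≤ 1) (hr20 : 0 ≤ r2) (hr21 : r2 ≤ 1) (hx10 : 0 ≤ x1) (hx11 : x1 ≤ 1) (hy10 : 0 ≤ y1)
    (hy11 : y1 ≤ 1) (hx20 : 0 ≤ x2) (hx21 : x2 ≤ 1) (hy20 : 0 ≤ y2) (hy21 : y2 ≤ 1)
    (H : ∀ k0 k1 k2 : ℕ, (k0 = 1 ∨ k0 = 2) → (k1 = 1 ∨ k1 = 2) → (k2 = 1 ∨ k2 = 2) → PartsOK q k0 k1 k2 x1 y1 x2 y2) :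
    CellsOK q [(r0, x1, y1), (r1, x2, y2)] r2 := by
  refine cellsOK_twoBlocks_of_parts (by linarith) hr00 hr01 hr10 hr11 hr20 hr21 (fun k0 k1 k2 h0 h1 h2 => ?_)
  by_cases hk : k0 = 0 ∨ k1 = 0 ∨ k2 = 0
  · exact partsOK_of_hasW hq0 hq1 hx10 hx11 hy10 hy11 hx20 hx21 hy20 hy21 hk
  · exact H k0 k1 k2 (by omega) (by omega) (by omega)

end WFree

end ThreeApex

end FK

end Summit.CriticalPhenomena.PercolationContinuityZ3.Theorems
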